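import Literature.Analysis.FluidPDE.FluidComputer.GalerkinUniqueness

/-!
# Lee's detailed Liouville theorem for the truncated Euler system

In the phase-space coordinates of `GalerkinUniqueness` (ALL complex arrays `x : ↥S → ℂ³`, the `û(k)`,
`k ∈ S`, treated as independent coordinates), the truncated advection term at wavevector `k`,
`N[x](k) = -i Σ_{p∈S} (k·x̃(k-p)) x̃(p)`, does NOT depend on the coordinate `x(k)` itself when the
mask does not contain the zero mode (`advArr_update_self`): the only summands that could involve
`x(k)` are `p = k` (through `x̃(k - k) = x̃(0) = 0`, as `0 ∉ S`) and `k - p = k`, i.e. `p = 0 ∉ S`.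
Hence every diagonal entry of the Jacobian of the inviscid Galerkin field vanishes — Lee's "detailed
Liouville theorem" `∂ẋ_k/∂x_k = 0` mode by mode, the basis of the absolute-equilibrium
(equipartition) statistical mechanics of truncated Euler flows: "the mathematical basis of (5.9) is the
validity of Liouville's theorem" [cite: Biskamp2003, §5.1 p. 90] (absolute equilibrium with energy and
helicity: Kraichnan1973 §2, cite-only acq-03732; originally T. D. Lee, Q. Appl. Math. 10 (1952) 69–74; in
the cell's reading list the thermalisation of truncated Euler runs, CichowlasBrachet2005, LITERATURE §C9.2). With viscosity the
diagonal entry is `-ν|k|²` (`vf_update_self`: the field at `k` changes by `-ν|k|²` times the change of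
`x(k)`, Leray-projected).

0 sorry, 0 named facts. HONEST FRAMING (cell pub-fluidc): typed infrastructure for a low prior, high
value-of-information experiment on Tao's machine paradigm; NOT a claim that NS blows up.
-/

noncomputable section

namespace Literature.Analysis.FluidPDE.FluidComputer

open Complex Finset
open scoped BigOperators

namespace ShellTransfer

namespace GalerkinODE

variable (S : Finset (Fin 3 → ℤ))

/-- Changing the coordinate `x(k)` does not change `x̃(q)` for `q ≠ k`. [folklore] -/
theorem extend_update_of_ne (x : ↥S → Fin 3 → ℂ) (k : ↥S) (v : Fin 3 → ℂ) {q : Fin 3 → ℤ}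
    (hq : q ≠ (k : Fin 3 → ℤ)) : extend S (Function.update x k v) q = extend S x q := by
  funext j
  unfold extend
  by_cases hqS : q ∈ S
  · rw [dif_pos hqS, dif_pos hqS]
    have hne : (⟨q, hqS⟩ : ↥S) ≠ k := fun h => hq (congrArg Subtype.val h)
    rw [Function.update_of_ne hne]
  · rw [dif_neg hqS, dif_neg hqS]

/-- `x̃(0) = 0` when `0 ∉ S`. [folklore] -/
theorem extend_zero_of_not_mem (h0 : (0 : Fin 3 → ℤ) ∉ S) (x : ↥S → Fin 3 → ℂ) : extend S x 0 = 0 := by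
  funext j
  unfold extend
  rw [dif_neg h0]
  rfl

/-- **LEE'S DETAILED LIOUVILLE THEOREM** (inviscid part): on a mask `S ∌ 0`, the truncated advection term
at `k ∈ S` is independent of the coordinate `x(k)`:
`N[update x k v](k) = N[x](k)` for every `v`. [cite: Biskamp2003, §5.1 p. 90] -/
theorem advArr_update_self (h0 : (0 : Fin 3 → ℤ) ∉ S) (x : ↥S → Fin 3 → ℂ) (k : ↥S) (v : Fin 3 → ℂ)
    (j : Fin 3) : advArr S (Function.update x k v) k j = advArr S x k j := by
  unfold advArr
  congr 1
  refine Finset.sum_congr rfl fun p hp => ?_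
  by_cases hpk : p = (k : Fin 3 → ℤ)
  · -- the summand `p = k` carries the factor `k · x̃(0) = 0` in both fields
    subst hpk
    rw [sub_self, extend_zero_of_not_mem S h0, extend_zero_of_not_mem S h0]
    unfold kdot
    simp
  · have hkp : (k : Fin 3 → ℤ) - p ≠ (k : Fin 3 → ℤ) := by
      intro h
      have : p = 0 := by
        have h' := congrArg (fun w => (k : Fin 3 → ℤ) - w) h
        simp only [sub_sub_cancel, sub_self] at h'
        exact h'
      exact h0 (this ▸ hp)
    rw [extend_update_of_ne S x k v hkp, extend_update_of_ne S x k v hpk]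

/-- Hence the (unforced) Galerkin field at `k` responds to a change of `x(k)` ONLY through the viscous
term: `F(update x k v)(k) - F(x)(k) = -ν|k|² (v - x(k))` — the diagonal Jacobian block is `-ν|k|² · Id`,
and `0` for truncated Euler (Liouville: the inviscid truncated flow preserves phase-space volume).
[cite: Biskamp2003, §5.1 p. 90] -/
theorem vf_update_self (h0 : (0 : Fin 3 → ℤ) ∉ S) (ν : ℝ) (g : (Fin 3 → ℤ) → Fin 3 → ℂ)
    (x : ↥S → Fin 3 → ℂ) (k : ↥S) (v : Fin 3 → ℂ) (j : Fin 3) :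
    vf S ν g (Function.update x k v) k j - vf S ν g x k j =
      -(ν : ℂ) * (knormSq (k : Fin 3 → ℤ) : ℂ) * (v j - x k j) := by
  unfold vf
  have e : (fun i => advArr S (Function.update x k v) k i + g k i) = fun i => advArr S x k i + g k i := by
    funext i; rw [advArr_update_self S h0]
  rw [e, Function.update_self]
  ring

/-- In particular for truncated EULER (`ν = 0`) the `k`-component of the field is literally unchanged
when `x(k)` is changed: `∂F_k/∂x_k = 0`. [cite: Biskamp2003, §5.1 p. 90] -/
theorem vf_update_self_euler (h0 : (0 : Fin 3 → ℤ) ∉ S) (g : (Fin 3 → ℤ) → Fin 3 → ℂ)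
    (x : ↥S → Fin 3 → ℂ) (k : ↥S) (v : Fin 3 → ℂ) :
    vf S 0 g (Function.update x k v) k = vf S 0 g x k := by
  funext j
  have h := vf_update_self S h0 0 g x k v j
  simp only [Complex.ofReal_zero, neg_zero, zero_mul] at h
  exact sub_eq_zero.mp h

end GalerkinODE

end ShellTransfer

end Literature.Analysis.FluidPDE.FluidComputer

end
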